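import Mathlib.Data.Real.Basic
import Mathlib.Tactic.Linarith
import Mathlib.Tactic.Ring
import Mathlib.Tactic.Positivity
import Mathlib.Tactic.FieldSimp
import HarnessLib

/-!
# The two-separation gluing theorem for the increasing star, I: the real-arithmetic core

Support file for the Sahi programme (`--supports stmt-CriticalPhenomena-4575`, prover prim-sahi-p2 gen 22).  No definitions, no named
facts, no sorries; standard axioms.  Memo `run/shared/lean/prim/prim-sahi/FROM-prim-sahi-p2-gen22-TWO-SEPARATION-GLUING.md` §1,
`prim-sahi-p2/PROOF-E3.md` §32.

SETTING (THEOREM G).  A weighted graph with root `s` and a separator `{s,x}`: `V ∖ {s,x} = L ⊔ R`, no positive pair between `L` and `R`;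
targets `a ∈ L`, `b, c ∈ R ∪ {x}`.  With the near-side numbers `α = P(A₀)`, `α_Λ = P(A₀ ∩ Λ)`, `d_a = P(D_a)`, `λ = P(Λ)` (`A₀ = {s~a}`,
`Λ = {s~x}`, `D_a = {a~x} ∖ Λ`, inside `L ∪ {s,x}` without the pair `(s,x)`) and the far-side numbers `β, γ, d_b, d_c, ρ, m_bc, σ, ρ_b, ρ_c, ρ_bc`
(`B₀ = {s~b}`, `D_b = {b~x} ∖ Ρ`, `Ρ = {s~x}` inside `R ∪ {s,x}` with the pair `(s,x)`; `σ = P(B₀D_c) + P(D_bC₀) + P(D_bD_c)`, `ρ_b = P(ΡB₀)` …)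
the seven moments of the root events `S_a, S_b, S_c` are near × far polynomials, and

  `E₃ = α·U(λ) + α_Λ·BR2(λ) + d_a·TD(λ)`  (`twoSep_sahiE3_poly`),

with `U = (m_bc − βγ) − λσ + λ²d_bd_c`, `BR2 = 2σ − βd_c − γd_b − 2λd_bd_c`,
`TD = (2ρ_bc − ρm_bc − βρ_c − γρ_b + ρβγ) + λ(ρ(βd_c + γd_b − σ) − d_bρ_c − d_cρ_b) + λ²ρd_bd_c`.
The near side enters only through `(α, α_Λ, d_a)`, linearly.  Its universal constraints `d_a ≥ 0`, `α_Λ ≤ α`, `λ(α + d_a) ≤ α_Λ` (Harris) span a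
simplicial cone with rays `(1,1,0), (1,λ,0), (λ,λ,1−λ)`, on which the form takes the values
`Φ = U + BR2`, `CovLam = U + λ·BR2`, `STAR⁺ = λΦ + (1−λ)TD`; hence the THREE-RAY IDENTITY
`(1−λ)E₃ = (α_Λ − λα − λd_a)Φ + (α − α_Λ)CovLam + d_a·STAR⁺` (`twoSep_threeRay_identity`) and `E₃ ≥ 0` as soon as `Φ, CovLam, STAR⁺ ≥ 0`
(`twoSep_threeRay_nonneg`).  The far-side facts `CovLam = (1−λ)Cov(B₀,C₀) + λCov(B₁,C₁) + λ(1−λ)d_bd_c` and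
`Φ = Cov(B₁,C₁) + (1−λ)σ + (1−λ)²d_bd_c` (`twoSep_covLam_eq`, `twoSep_phi_eq`) reduce `Φ, CovLam ≥ 0` to Harris on the far side, and `STAR⁺`
is Sahi's cubic of the far side with the root weight at `x` boosted by `λ`.  This file is the pure real-arithmetic layer; the event layer
(dictionary across `{s,x}`, independence, moments) follows in `…IncStarTwoSepEvents` / `…IncStarTwoSepGlue`.
-/

namespace Summit.CriticalPhenomena.PercolationContinuityZ3.Theorems

namespace IncStar

/-- **`E₃` across a two-separation as a near-linear form.**  With the seven moments of `(S_a, S_b, S_c)` written as near × far polynomials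
(memo §1: `P(S_a) = α + d_aρ`, `P(S_b) = β + λd_b`, `P(S_bS_c) = m_bc + λσ`, `P(S_aS_b) = αβ + α_Λd_b + d_aρ_b`, `P(S_aS_bS_c) = αm_bc + α_Λσ + d_aρ_bc`),
Sahi's cubic `2P(ABC) + P(A)P(B)P(C) − Σ P(A)P(BC)` equals `α·U + α_Λ·BR2 + d_a·TD`. [this work] -/
theorem twoSep_sahiE3_poly (α αΛ da lam β γ db dc ρ mbc σ ρb ρc ρbc : ℝ) :
    2 * (α * mbc + αΛ * σ + da * ρbc) + (α + da * ρ) * (β + lam * db) * (γ + lam * dc)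
      - ((α + da * ρ) * (mbc + lam * σ) + (β + lam * db) * (α * γ + αΛ * dc + da * ρc)
          + (γ + lam * dc) * (α * β + αΛ * db + da * ρb))
      = α * ((mbc - β * γ) - lam * σ + lam ^ 2 * (db * dc))
        + αΛ * (2 * σ - β * dc - γ * db - 2 * lam * (db * dc))
        + da * ((2 * ρbc - ρ * mbc - β * ρc - γ * ρb + ρ * β * γ)
            + lam * (ρ * (β * dc + γ * db - σ) - db * ρc - dc * ρb) + lam ^ 2 * (ρ * db * dc)) := by
  ring

/-- **The value on the ray `(1, λ, 0)`**: `U + λ·BR2 = (1−λ)Cov(B₀,C₀) + λCov(B₁,C₁) + λ(1−λ)d_bd_c` (`Cov(B₁,C₁) = (m_bc + σ) − (β + d_b)(γ + d_c)`).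
[this work] -/
theorem twoSep_covLam_eq (lam β γ db dc mbc σ : ℝ) :
    ((mbc - β * γ) - lam * σ + lam ^ 2 * (db * dc)) + lam * (2 * σ - β * dc - γ * db - 2 * lam * (db * dc))
      = (1 - lam) * (mbc - β * γ) + lam * ((mbc + σ) - (β + db) * (γ + dc)) + lam * (1 - lam) * (db * dc) := by
  ring

/-- **The value on the ray `(1, 1, 0)`**: `U + BR2 = Cov(B₁,C₁) + (1−λ)σ + (1−λ)²d_bd_c`. [this work] -/
theorem twoSep_phi_eq (lam β γ db dc mbc σ : ℝ) :
    ((mbc - β * γ) - lam * σ + lam ^ 2 * (db * dc)) + (2 * σ - β * dc - γ * db - 2 * lam * (db * dc))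
      = ((mbc + σ) - (β + db) * (γ + dc)) + (1 - lam) * σ + (1 - lam) ^ 2 * (db * dc) := by
  ring

/-- `CovLam ≥ 0` from Harris on the far side (`Cov(B₀,C₀), Cov(B₁,C₁) ≥ 0`) and `d_b, d_c ≥ 0`, `0 ≤ λ ≤ 1`. [this work] -/
theorem twoSep_covLam_nonneg (lam β γ db dc mbc σ : ℝ) (hl0 : 0 ≤ lam) (hl1 : lam ≤ 1)
    (hdb : 0 ≤ db) (hdc : 0 ≤ dc) (h0 : β * γ ≤ mbc) (h1 : (β + db) * (γ + dc) ≤ mbc + σ) :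
    0 ≤ ((mbc - β * γ) - lam * σ + lam ^ 2 * (db * dc)) + lam * (2 * σ - β * dc - γ * db - 2 * lam * (db * dc)) := by
  rw [twoSep_covLam_eq]
  have h2 : 0 ≤ lam * (1 - lam) * (db * dc) := mul_nonneg (mul_nonneg hl0 (by linarith)) (mul_nonneg hdb hdc)
  have h3 : 0 ≤ (1 - lam) * (mbc - β * γ) := mul_nonneg (by linarith) (by linarith)
  have h4 : 0 ≤ lam * ((mbc + σ) - (β + db) * (γ + dc)) := mul_nonneg hl0 (by linarith)
  linarith

/-- `Φ ≥ 0` from Harris on the far side (`Cov(B₁,C₁) ≥ 0`) and `σ, d_b, d_c ≥ 0`, `λ ≤ 1`. [this work] -/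
theorem twoSep_phi_nonneg (lam β γ db dc mbc σ : ℝ) (hl1 : lam ≤ 1) (hσ : 0 ≤ σ)
    (hdb : 0 ≤ db) (hdc : 0 ≤ dc) (h1 : (β + db) * (γ + dc) ≤ mbc + σ) :
    0 ≤ ((mbc - β * γ) - lam * σ + lam ^ 2 * (db * dc)) + (2 * σ - β * dc - γ * db - 2 * lam * (db * dc)) := by
  rw [twoSep_phi_eq]
  have h2 : 0 ≤ (1 - lam) * σ := mul_nonneg (by linarith) hσ
  have h3 : 0 ≤ (1 - lam) ^ 2 * (db * dc) := mul_nonneg (sq_nonneg _) (mul_nonneg hdb hdc)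
  linarith

/-- **The three-ray identity** (pure algebra): the near-linear form against the decomposition of `(α, α_Λ, d_a)` along the rays `(1,1,0)`,
`(1,λ,0)`, `(λ,λ,1−λ)`. [this work] -/
theorem twoSep_threeRay_identity (lam α αΛ da U BR2 TD : ℝ) :
    (1 - lam) * (α * U + αΛ * BR2 + da * TD)
      = (αΛ - lam * α - lam * da) * (U + BR2) + (α - αΛ) * (U + lam * BR2) + da * (lam * (U + BR2) + (1 - lam) * TD) := by
  ring

/-- **The three-ray inequality.**  If `0 ≤ λ ≤ 1`, `0 ≤ α`, `0 ≤ d_a`, `α_Λ ≤ α`, `λ(α + d_a) ≤ α_Λ` (the near-side constraints) and the form is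
nonnegative on the three rays — `0 ≤ Φ = U + BR2`, `0 ≤ CovLam = U + λBR2`, `0 ≤ STAR⁺ = λΦ + (1−λ)TD` — then `0 ≤ αU + α_ΛBR2 + d_aTD`. [this work] -/
theorem twoSep_threeRay_nonneg (lam α αΛ da U BR2 TD : ℝ) (hl0 : 0 ≤ lam) (hl1 : lam ≤ 1) (hα : 0 ≤ α) (hda : 0 ≤ da)
    (hαΛ : αΛ ≤ α) (hL2 : lam * (α + da) ≤ αΛ)
    (hΦ : 0 ≤ U + BR2) (hCov : 0 ≤ U + lam * BR2) (hStar : 0 ≤ lam * (U + BR2) + (1 - lam) * TD) :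
    0 ≤ α * U + αΛ * BR2 + da * TD := by
  rcases eq_or_lt_of_le hl1 with h1 | h1
  · -- `λ = 1`: the constraints force `d_a = 0`, `α_Λ = α`
    subst h1
    have hda0 : da = 0 := by linarith
    have hαΛ' : αΛ = α := by linarith
    subst hda0; subst hαΛ'
    have : αΛ * U + αΛ * BR2 + 0 * TD = αΛ * (U + BR2) := by ring
    rw [this]; exact mul_nonneg hα hΦ
  · have hpos : 0 < 1 - lam := by linarith
    have key := twoSep_threeRay_identity lam α αΛ da U BR2 TD
    have h1' : 0 ≤ (αΛ - lam * α - lam * da) * (U + BR2) := mul_nonneg (by linarith) hΦ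
    have h2' : 0 ≤ (α - αΛ) * (U + lam * BR2) := mul_nonneg (by linarith) hCov
    have h3' : 0 ≤ da * (lam * (U + BR2) + (1 - lam) * TD) := mul_nonneg hda hStar
    have hprod : 0 ≤ (1 - lam) * (α * U + αΛ * BR2 + da * TD) := by rw [key]; linarith
    by_contra hneg
    push Not at hneg
    have : (1 - lam) * (α * U + αΛ * BR2 + da * TD) < 0 := mul_neg_of_pos_of_neg hpos hneg
    linarith

/-- **The gluing inequality in moment form.**  Near-side constraints + Harris on the far side (`βγ ≤ m_bc`, `(β+d_b)(γ+d_c) ≤ m_bc + σ`) + the boosted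
far star `0 ≤ λΦ + (1−λ)TD` give `0 ≤ E₃` written through the seven near × far moments. [this work] -/
theorem twoSep_glue_moments (α αΛ da lam β γ db dc ρ mbc σ ρb ρc ρbc : ℝ)
    (hl0 : 0 ≤ lam) (hl1 : lam ≤ 1) (hα : 0 ≤ α) (hda : 0 ≤ da) (hαΛ : αΛ ≤ α) (hL2 : lam * (α + da) ≤ αΛ)
    (hσ : 0 ≤ σ) (hdb : 0 ≤ db) (hdc : 0 ≤ dc) (h0 : β * γ ≤ mbc) (h1 : (β + db) * (γ + dc) ≤ mbc + σ)
    (hStar : 0 ≤ lam * (((mbc - β * γ) - lam * σ + lam ^ 2 * (db * dc)) + (2 * σ - β * dc - γ * db - 2 * lam * (db * dc)))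
        + (1 - lam) * ((2 * ρbc - ρ * mbc - β * ρc - γ * ρb + ρ * β * γ)
            + lam * (ρ * (β * dc + γ * db - σ) - db * ρc - dc * ρb) + lam ^ 2 * (ρ * db * dc))) :
    0 ≤ 2 * (α * mbc + αΛ * σ + da * ρbc) + (α + da * ρ) * (β + lam * db) * (γ + lam * dc)
      - ((α + da * ρ) * (mbc + lam * σ) + (β + lam * db) * (α * γ + αΛ * dc + da * ρc)
          + (γ + lam * dc) * (α * β + αΛ * db + da * ρb)) := by
  rw [twoSep_sahiE3_poly]
  exact twoSep_threeRay_nonneg lam α αΛ da _ _ _ hl0 hl1 hα hda hαΛ hL2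
    (twoSep_phi_nonneg lam β γ db dc mbc σ hl1 hσ hdb hdc h1)
    (twoSep_covLam_nonneg lam β γ db dc mbc σ hl0 hl1 hdb hdc h0 h1) hStar

end IncStar

end Summit.CriticalPhenomena.PercolationContinuityZ3.Theorems
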